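import Mathlib
import Summits.CriticalPhenomena.PercolationContinuityZ3.Theses.PercNearOneGluing
import Literature.Probability.Percolation.PercolationEvents
import Literature.Probability.LatticeModels.ProdBernoulliIndependence
import Literature.Probability.LatticeModels.ProdBernoulliCoupling
import HarnessLib.Audit

/-! TTRL-lite variant V2373 of stmt-CriticalPhenomena-4574 -/

namespace Summit.CriticalPhenomena.PercolationContinuityZ3.Theorems

open MeasureTheory Set Literature.Probability.LatticeModels Literature.Probability.Percolation
open scoped Classical BigOperators

/-- TTRL-lite variant V2373 (`n := 3`) of the shortening step `stub_shorteningStep`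
(Kozma–Nitzan Conjecture 6 with the induction hypothesis displayed) of stmt-CriticalPhenomena-4574.
On three vertices the claim holds unconditionally: in the contracted graph `w[s(v,x) ↦ 1]` the pair
`s(v, x)` is almost surely open, so `P(x ↔ z) ≤ P(v ↔ z)` for every `z` (Harris), and the case
analysis `b ∈ {v, x}` / `a₀ = b` / `a₀ = x` closes the inequality. -/
theorem stub_shorteningStep_var2373 :
    ∀ (w : Sym2 (Fin 3) → unitInterval) (A : Finset (Fin 3)) (b v x a₀ : Fin 3), v ∉ A → v ≠ x →
      w s(v, x) = 0 → a₀ ∈ A →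
      (∀ a ∈ A, (prodBernoulli w).real (openConn a₀ b) ≤ (prodBernoulli w).real (openConn a b)) →
      (∀ w' : Sym2 (Fin 3) → unitInterval, (∀ e, w e = 0 → w' e = 0) →
        ∀ (A' : Finset (Fin 3)) (o' b' : Fin 3) (t : ℝ),
          (∀ a ∈ A', t ≤ (prodBernoulli w').real (openConn a b')) →
          (prodBernoulli w').real (⋃ a ∈ A', openConn o' a) * t ≤
            (prodBernoulli w').real (openConn o' b')) →
      (prodBernoulli (Function.update w s(v, x) 1)).real (⋃ a ∈ A, openConn v a) *
          (prodBernoulli (Function.update w s(v, x) 1)).real (openConn a₀ b) ≤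
        (prodBernoulli (Function.update w s(v, x) 1)).real (openConn v b) := by
  intro w A b v x a₀ hvA hvx hw0 ha₀ hmin _hIH
  set w1 : Sym2 (Fin 3) → unitInterval := Function.update w s(v, x) 1 with hw1
  -- measurability of every event (finite configuration space)
  have hmeas : ∀ S : Set (BondConfig (Fin 3)), MeasurableSet S := fun S =>
    (Set.toFinite S).measurableSet
  -- all probabilities lie in `[0, 1]`
  have hle1 : ∀ S : Set (BondConfig (Fin 3)), (prodBernoulli w1).real S ≤ 1 := fun S =>
    measureReal_le_one
  have hnn : ∀ S : Set (BondConfig (Fin 3)), 0 ≤ (prodBernoulli w1).real S := fun S =>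
    measureReal_nonneg
  have hprod_le_one : ∀ S T : Set (BondConfig (Fin 3)),
      (prodBernoulli w1).real S * (prodBernoulli w1).real T ≤ 1 := fun S T =>
    mul_le_one₀ (hle1 S) (hnn T) (hle1 T)
  -- `P(z ↔ z) = 1` for every weight function
  have huniv : ∀ z : Fin 3, (openConn z z : Set (BondConfig (Fin 3))) = Set.univ := fun z =>
    Set.eq_univ_of_forall fun ω => (SimpleGraph.Reachable.refl z : (openGraph ω).Reachable z z)
  have hself : ∀ (p : Sym2 (Fin 3) → unitInterval) (z : Fin 3),
      (prodBernoulli p).real (openConn z z) = 1 := fun p z => by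
    rw [huniv z]; exact probReal_univ
  -- F1: in the contracted graph the pair `s(v, x)` is a.s. open, so `P(v ↔ x) = 1`
  have hvx1 : (prodBernoulli w1).real (openConn v x) = 1 := by
    refine le_antisymm (hle1 _) ?_
    have h1 : (prodBernoulli w1).real {ω | s(v, x) ∈ ω} = 1 := by
      rw [prodBernoulli_real_setOf_mem]
      simp [hw1]
    rw [← h1]
    refine measureReal_mono (fun ω hω => ?_)
    have hadj : (openGraph ω).Adj v x := (openGraph_adj ω v x).2 ⟨hω, hvx⟩
    exact hadj.reachable
  -- F2: `P(x ↔ z) ≤ P(v ↔ z)` in the contracted graph (Harris with the sure event `v ↔ x`)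
  have hxz : ∀ z : Fin 3, (prodBernoulli w1).real (openConn x z) ≤
      (prodBernoulli w1).real (openConn v z) := by
    intro z
    have hsub : (openConn v x ∩ openConn x z : Set (BondConfig (Fin 3))) ⊆ openConn v z :=
      fun ω hω => SimpleGraph.Reachable.trans (hω.1 : (openGraph ω).Reachable v x) hω.2
    have hH := prodBernoulli_harris w1 (isUpperSet_openConn v x) (isUpperSet_openConn x z)
      (hmeas _) (hmeas _)
    rw [hvx1, one_mul] at hH
    exact hH.trans (measureReal_mono hsub)
  -- case `b = v`
  by_cases hbv : b = v
  · rw [hbv, hself w1 v]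
    exact hprod_le_one _ _
  -- case `b = x`
  by_cases hbx : b = x
  · rw [hbx, hvx1]
    exact hprod_le_one _ _
  -- now `v, x, b` are the three vertices
  have key : ∀ v' x' b' a : Fin 3, v' ≠ x' → b' ≠ v' → b' ≠ x' → a = v' ∨ a = x' ∨ a = b' := by
    decide
  have htri : ∀ a : Fin 3, a = v ∨ a = x ∨ a = b := fun a => key v x b a hvx hbv hbx
  by_cases hab : a₀ = b
  · -- the minimiser is the target: `P(a₀ ↔ b) = 1`
    rw [hab, hself w1 b, mul_one]
    by_cases hxA : x ∈ A
    · -- `P_w(x ↔ b) = 1`, hence `P(v ↔ b) = 1` in the contracted graph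
      have h1 : (1 : ℝ) ≤ (prodBernoulli w).real (openConn x b) := by
        have := hmin x hxA
        rwa [hab, hself w b] at this
      have hww1 : w ≤ w1 := by
        intro e
        by_cases he : e = s(v, x)
        · rw [he, hw0]; exact bot_le
        · rw [hw1, Function.update_of_ne he]
      have h2 : (prodBernoulli w).real (openConn x b) ≤ (prodBernoulli w1).real (openConn x b) :=
        prodBernoulli_real_mono_of_isUpperSet hww1 (isUpperSet_openConn x b) (hmeas _)
      exact (hle1 _).trans (h1.trans (h2.trans (hxz b)))
    · -- `A = {b}`: the union is `openConn v b`
      refine measureReal_mono (fun ω hω => ?_)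
      simp only [mem_iUnion, exists_prop] at hω
      obtain ⟨a, haA, hωa⟩ := hω
      rcases htri a with rfl | rfl | rfl
      · exact absurd haA hvA
      · exact absurd haA hxA
      · exact hωa
  · -- the minimiser is `x`
    have hax : a₀ = x := by
      rcases htri a₀ with h | h | h
      · exact absurd (h ▸ ha₀) hvA
      · exact h
      · exact absurd h hab
    rw [hax]
    calc (prodBernoulli w1).real (⋃ a ∈ A, openConn v a) * (prodBernoulli w1).real (openConn x b)
        ≤ 1 * (prodBernoulli w1).real (openConn x b) :=
          mul_le_mul_of_nonneg_right (hle1 _) (hnn _)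
      _ = (prodBernoulli w1).real (openConn x b) := one_mul _
      _ ≤ (prodBernoulli w1).real (openConn v b) := hxz b

end Summit.CriticalPhenomena.PercolationContinuityZ3.Theorems
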